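import Mathlib
import Summits.KontsevichZagierPeriods.KontsevichZagierPeriods.Theorems.TorsionLogsNeronTorsionSectorStubTranslationStep
import Summits.KontsevichZagierPeriods.KontsevichZagierPeriods.Theorems.TorsionLogsNeronTorsionSectorStubCornerChartLower
import Summits.KontsevichZagierPeriods.KontsevichZagierPeriods.Theorems.HyperbolicBlochOffTetraSectorKernelRungZeroLogRelations
import HarnessLib

/-!
# Stub `stub_foldStepInst` — crux `TorsionLogs.NeronTorsionSector`, line `registered` (block S2)

The FOLD of the translation chain at the 2-torsion end of the real identity component of
`y² = f(x) = 4x³ − g₂x − g₃`: on the last row `(b, c) = (e₁, x_{m−1})` (`b = e₁` allowed, `1/√f`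
being integrable there by hypothesis, `f > 0` on the open row) the translation `τ` is strictly
DECREASING on `[b, c]` and maps `(b, c)` onto itself, so `τ × τ` maps the source half-cell
`Tsrc = [{b < x′ < x < c}, h(x′)/(√f(x)√f(x′))]` onto the TRANSPOSED half-cell
`Ttgt = [{b < x < x′ < c}, h(x′)/(√f(x)√f(x′))]`, `h(x) = (g₂x + 2g₃)/(4x²)`, and
`[Ttgt] − [Tsrc] − [(b,c), (Qf(b) − Qf(x))/√f(x)] ∈ KZ.relations`.

This is ONE application of the landed generic translation step `stub_translationStep` with
`φ = ψ = τ`, `A = B = A′ = B′ = (b, c)`, `J = [b, c]`, all four weights `1/√f` (the Haar identity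
`|τ′|√f = √f∘τ` in the form `(√f∘τ)⁻¹·|τ′| = (√f)⁻¹`), kernels `kS = kT = h`, fibres `(b, x)` and
potential `Q = Qf` (`Qf′ = (h∘τ − h)/(−√f)`); the image identity
`(τ × τ){b < z₁ < z₀ < c} = {b < w₀ < w₁ < c}` is anti-monotonicity plus surjectivity of `τ` on the
open row.

References: M. Kontsevich, D. Zagier, *Periods* (2001), §1.2 rules (1)–(3); J. Bochnak, M. Coste,
M.-F. Roy, *Real Algebraic Geometry* (1998), §2.2, Prop. 2.2.6.
-/

noncomputable section

-- `Summit.KontsevichZagierPeriods.KontsevichZagierPeriods.…` is the tree's mandated layout (single-conjunct summit).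
set_option linter.dupNamespace false

open Set MeasureTheory MvPolynomial
open Literature.NumberTheory.Transcendental Literature.ModelTheory.ExponentialFields
open Summit.KontsevichZagierPeriods.HyperbolicBloch.OffTetraSectorKernel (isSemialgebraic_logIvl)

namespace Summit.KontsevichZagierPeriods.KontsevichZagierPeriods.Cruxes.NeronTorsionSector.Translation

/-- **The Haar identity in inverse-weight form.** If `a·s = t` with `s, t > 0` (here `a = |τ′ x|`,
`s = √f(x)`, `t = √f(τ x)`), then `t⁻¹·a = s⁻¹`, i.e. `u₀(φ x)|φ′ x| = w₀ x` for the weights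
`u₀ = w₀ = 1/√f`. [cite: KontsevichZagier2001, §1.2 rule (2)] -/
theorem foldStep_inv_mul_of_mul_eq {s t a : ℝ} (hs : 0 < s) (ht : 0 < t) (h : a * s = t) :
    t⁻¹ * a = s⁻¹ := by
  have ha : a ≠ 0 := by
    rintro rfl
    rw [zero_mul] at h
    exact ht.ne h
  have hs' : s ≠ 0 := hs.ne'
  subst h
  field_simp

/-- **Shape of the fibre derivative**: `A/(−s) = −(A·s⁻¹)` (the potential's derivative
`(h∘τ − h)/(−√f)` in the form `−((kT∘ψ − kS)·w₁)` of `stub_translationStep`). [folklore] -/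
theorem foldStep_div_neg_eq (A s : ℝ) : A / -s = -(A * s⁻¹) := by
  rw [div_neg, div_eq_mul_inv]

/-- **Shape of the half-cell integrand**: `A/(s₀·s₁) = A·s₀⁻¹·s₁⁻¹` (the Haar integrand
`h(x′)/(√f(x)√f(x′))` in the form `kS(x′)·w₀(x)·w₁(x′)` of `stub_translationStep`). [folklore] -/
theorem foldStep_div_mul_eq (A s₀ s₁ : ℝ) : A / (s₀ * s₁) = A * s₀⁻¹ * s₁⁻¹ := by
  rw [div_eq_mul_inv, mul_inv, mul_assoc]

/-- **The second-kind kernel `h(x) = (g₂x + 2g₃)/(4x²)` is `ℚ`-semialgebraic** on the cylinder over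
any `ℚ`-semialgebraic `S ⊆ ℝ ∖ {0}` (`g₂, g₃` algebraic over `ℚ`; closure of `ℚ`-semialgebraic
functions under `+`, `*`, `/`, `isSemialgebraicFunOn_const_of_isAlgebraic`).
[cite: BochnakCosteRoy1998, Prop. 2.2.6] -/
theorem foldStep_kernel_isSemialgebraicFunOn {S : Set ℝ}
    (hS : IsSemialgebraic ℚ {t : Fin 1 → ℝ | t 0 ∈ S}) {g₂ g₃ : ℝ} (h₂ : IsAlgebraic ℚ g₂)
    (h₃ : IsAlgebraic ℚ g₃) (h0 : ∀ x ∈ S, x ≠ 0) :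
    IsSemialgebraicFunOn ℚ {t : Fin 1 → ℝ | t 0 ∈ S}
      (fun t => (g₂ * t 0 + 2 * g₃) / (4 * t 0 ^ 2)) := by
  -- adapted from the kernel step of `stub_rIReduction` (TorsionLogsNeronTorsionSectorStubRIReduction)
  have hX0 : IsSemialgebraicFunOn ℚ {t : Fin 1 → ℝ | t 0 ∈ S} (fun t => t 0) :=
    (isSemialgebraicFunOn_aeval hS (X 0)).congr fun t _ => by simp
  have hc₂ := isSemialgebraicFunOn_const_of_isAlgebraic hS h₂
  have hc₃ := isSemialgebraicFunOn_const_of_isAlgebraic hS ((isAlgebraic_nat 2).mul h₃)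
  have hden : IsSemialgebraicFunOn ℚ {t : Fin 1 → ℝ | t 0 ∈ S} (fun t => 4 * t 0 ^ 2) :=
    (isSemialgebraicFunOn_aeval hS (C 4 * X 0 ^ 2)).congr fun t _ => by simp
  have hnum : IsSemialgebraicFunOn ℚ {t : Fin 1 → ℝ | t 0 ∈ S} (fun t => g₂ * t 0 + 2 * g₃) :=
    (IsSemialgebraicFunOn.add_holds (IsSemialgebraicFunOn.mul_holds hc₂ hX0) hc₃).congr
      fun t _ => by simp
  exact hnum.div hden fun t ht => mul_ne_zero four_ne_zero (pow_ne_zero 2 (h0 _ ht))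

/-- **The image of the half-cell under `τ × τ` for a decreasing `τ`.** If `τ` is strictly
decreasing on `[b, c]` and maps `(b, c)` onto `(b, c)`, then
`(τ × τ)({b < z₁ < z₀ < c}) = {b < w₀ < w₁ < c}`: the order of the two coordinates is reversed
(anti-monotonicity) and every point of the transposed half-cell is hit (surjectivity onto the open
row). [cite: KontsevichZagier2001, §1.2 rule (2)] -/
theorem foldStep_image_halfCell {τ : ℝ → ℝ} {b c : ℝ} (hanti : StrictAntiOn τ (Set.Icc b c))
    (himg : τ '' Set.Ioo b c = Set.Ioo b c) :
    {z : Fin 2 → ℝ | b < z 0 ∧ z 0 < z 1 ∧ z 1 < c} =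
      (fun z : Fin 2 → ℝ => (![τ (z 0), τ (z 1)] : Fin 2 → ℝ)) ''
        {z : Fin 2 → ℝ | b < z 1 ∧ z 1 < z 0 ∧ z 0 < c} := by
  ext w
  simp only [mem_setOf_eq, mem_image]
  constructor
  · rintro ⟨h1, h2, h3⟩
    obtain ⟨z0, hz0, e0⟩ : w 0 ∈ τ '' Ioo b c := by
      rw [himg]
      exact ⟨h1, h2.trans h3⟩
    obtain ⟨z1, hz1, e1⟩ : w 1 ∈ τ '' Ioo b c := by
      rw [himg]
      exact ⟨h1.trans h2, h3⟩
    have hlt : z1 < z0 := by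
      by_contra hle
      have hle' : τ z1 ≤ τ z0 :=
        hanti.antitoneOn (Ioo_subset_Icc_self hz0) (Ioo_subset_Icc_self hz1) (not_lt.1 hle)
      rw [e0, e1] at hle'
      exact absurd h2 (not_lt.2 hle')
    refine ⟨![z0, z1], ?_, ?_⟩
    · simp only [Matrix.cons_val_zero, Matrix.cons_val_one]
      exact ⟨hz1.1, hlt, hz0.2⟩
    · refine funext (Fin.forall_fin_two.mpr ⟨?_, ?_⟩)
      · simpa using e0
      · simpa using e1
  · rintro ⟨z, ⟨h1, h2, h3⟩, rfl⟩
    simp only [Matrix.cons_val_zero, Matrix.cons_val_one]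
    have hz0 : z 0 ∈ Icc b c := ⟨(h1.trans h2).le, h3.le⟩
    have hz1 : z 1 ∈ Icc b c := ⟨h1.le, (h2.trans h3).le⟩
    have hτ0 : τ (z 0) ∈ Ioo b c := himg.subset (mem_image_of_mem τ ⟨h1.trans h2, h3⟩)
    have hτ1 : τ (z 1) ∈ Ioo b c := himg.subset (mem_image_of_mem τ ⟨h1, h2.trans h3⟩)
    exact ⟨hτ0.1, hanti hz1 hz0 h2, hτ1.2⟩

/-- **STUB S2 (`stub_foldStepInst`) — the fold at the 2-torsion end:
`t′_{m−1} ≡ t_{m−1} + [row, (q_m − Qf)/√f]`.** On the last row `(b, c) = (e₁, x_{m−1})`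
(`b = e₁` allowed: `1/√f` is integrable there), `τ` is DECREASING and maps `(b,c)` onto itself, so
`τ × τ` maps the half-cell `{b < x′ < x < c}` onto the transposed half-cell `{b < x < x′ < c}`, and
`[Ttgt] − [Tsrc] − [(b,c), (Qf b − Qf x)/√f x] ∈ KZ.relations`. Proof: ONE application of the landed
`stub_translationStep` with `φ = ψ = τ`, `A = B = A′ = B′ = (b,c)`, `J = [b,c]`, weights `1/√f`
(Haar identity `|τ′|√f = √f∘τ`, `foldStep_inv_mul_of_mul_eq`), kernels `kS = kT = h`
(`foldStep_kernel_isSemialgebraicFunOn`), fibres `(b, x)`, potential `Qf`, image identity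
`foldStep_image_halfCell`. [cite: KontsevichZagier2001, §1.2] -/
theorem stub_foldStepInst :
    ∀ (g₂ g₃ e₁ b c Cb : ℝ) (f τ τ' Qf : ℝ → ℝ)
      (Tsrc Ttgt : Literature.NumberTheory.Transcendental.KZ.IntegralRep 2)
      (rO : Literature.NumberTheory.Transcendental.KZ.IntegralRep 1),
    (∀ x, f x = 4 * x ^ 3 - g₂ * x - g₃) → IsAlgebraic ℚ g₂ → IsAlgebraic ℚ g₃ →
    IsAlgebraic ℚ b → IsAlgebraic ℚ c →
    0 < e₁ → e₁ ≤ b → b < c → (∀ x, e₁ < x → 0 < f x) →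
    (∀ x, e₁ < x → |(g₂ * x + 2 * g₃) / (4 * x ^ 2)| ≤ Cb) →
    MeasureTheory.IntegrableOn (fun t => (Real.sqrt (f t))⁻¹) (Set.Ioo b c) →
    StrictAntiOn τ (Set.Icc b c) → τ '' Set.Ioo b c = Set.Ioo b c →
    (∀ x ∈ Set.Ioo b c, HasDerivAt τ (τ' x) x ∧ |τ' x| * Real.sqrt (f x) = Real.sqrt (f (τ x))) →
    IsSemialgebraicFunOn ℚ {t : Fin 1 → ℝ | t 0 ∈ Set.Ioo b c} (fun t => τ (t 0)) →
    IsSemialgebraicFunOn ℚ {t : Fin 1 → ℝ | t 0 ∈ Set.Icc b c} (fun t => Qf (t 0)) →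
    ContinuousOn Qf (Set.Icc b c) →
    (∀ x ∈ Set.Ioo b c, HasDerivAt Qf
      (((g₂ * τ x + 2 * g₃) / (4 * τ x ^ 2) - (g₂ * x + 2 * g₃) / (4 * x ^ 2)) / (-Real.sqrt (f x))) x) →
    Tsrc.domain = {z | b < z 1 ∧ z 1 < z 0 ∧ z 0 < c} →
    Set.EqOn Tsrc.integrand
      (fun z => (g₂ * z 1 + 2 * g₃) / (4 * (z 1) ^ 2) / (Real.sqrt (f (z 0)) * Real.sqrt (f (z 1)))) Tsrc.domain →
    Ttgt.domain = {z | b < z 0 ∧ z 0 < z 1 ∧ z 1 < c} →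
    Set.EqOn Ttgt.integrand
      (fun z => (g₂ * z 1 + 2 * g₃) / (4 * (z 1) ^ 2) / (Real.sqrt (f (z 0)) * Real.sqrt (f (z 1)))) Ttgt.domain →
    rO.domain = {t | b < t 0 ∧ t 0 < c} →
    Set.EqOn rO.integrand (fun t => (Qf b - Qf (t 0)) / Real.sqrt (f (t 0))) rO.domain →
    Literature.NumberTheory.Transcendental.KZ.of Ttgt - Literature.NumberTheory.Transcendental.KZ.of Tsrc
      - Literature.NumberTheory.Transcendental.KZ.of rO ∈ Literature.NumberTheory.Transcendental.KZ.relations := by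
  intro g₂ g₃ e₁ b c Cb f τ τ' Qf Tsrc Ttgt rO hf h₂ h₃ hb hc he₁ he₁b _hbc hpos hCb hint hanti himg
    hτder hτsa hQsa hQc hQder hSd hSi hTd hTi hOd hOi
  -- the open row `(b, c)` lies in `(e₁, ∞)`, where `f > 0`
  have hrow : ∀ x ∈ Ioo b c, e₁ < x := fun x hx => he₁b.trans_lt hx.1
  have hsq : ∀ x ∈ Ioo b c, 0 < Real.sqrt (f x) := fun x hx => Real.sqrt_pos.2 (hpos x (hrow x hx))
  -- the `ℚ`-semialgebraic cylinders over `A = B = A′ = B′ = (b, c)` and `J = [b, c]`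
  have hAsa : IsSemialgebraic ℚ {t : Fin 1 → ℝ | t 0 ∈ Ioo b c} := isSemialgebraic_logIvl hb hc
  have hJsa : IsSemialgebraic ℚ {t : Fin 1 → ℝ | t 0 ∈ Icc b c} :=
    cornerLower_isSemialgebraic_slab hb hc
  -- `τ`: injective on the row, maps the row onto itself, Haar identity in inverse-weight form
  have hτinj : InjOn τ (Ioo b c) := hanti.injOn.mono Ioo_subset_Icc_self
  have hτmaps : MapsTo τ (Ioo b c) (Ioo b c) := fun x hx => himg.subset (mem_image_of_mem τ hx)
  have hτhaar : ∀ x ∈ Ioo b c, HasDerivAt τ (τ' x) x ∧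
      (Real.sqrt (f (τ x)))⁻¹ * |τ' x| = (Real.sqrt (f x))⁻¹ := fun x hx =>
    ⟨(hτder x hx).1, foldStep_inv_mul_of_mul_eq (hsq x hx) (hsq _ (hτmaps hx)) (hτder x hx).2⟩
  -- the `ℚ`-semialgebraic weight `1/√f`, kernel `h`, fibre bounds `b`, `x`
  have hwsa : IsSemialgebraicFunOn ℚ {t : Fin 1 → ℝ | t 0 ∈ Ioo b c}
      (fun t => (Real.sqrt (f (t 0)))⁻¹) :=
    (isSemialgebraicFunOn_sqrt_cubic_apply hAsa h₂ h₃ hf 0).inv fun t ht => (hsq _ ht).ne'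
  have hksa : IsSemialgebraicFunOn ℚ {t : Fin 1 → ℝ | t 0 ∈ Ioo b c}
      (fun t => (g₂ * t 0 + 2 * g₃) / (4 * t 0 ^ 2)) :=
    foldStep_kernel_isSemialgebraicFunOn hAsa h₂ h₃ fun x hx => (he₁.trans (hrow x hx)).ne'
  have hX0 : IsSemialgebraicFunOn ℚ {t : Fin 1 → ℝ | t 0 ∈ Ioo b c} (fun t => t 0) :=
    (isSemialgebraicFunOn_aeval hAsa (X 0)).congr fun t _ => by simp
  have hbsa : IsSemialgebraicFunOn ℚ {t : Fin 1 → ℝ | t 0 ∈ Ioo b c} (fun _ => b) :=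
    isSemialgebraicFunOn_const_of_isAlgebraic hAsa hb
  -- kernel bound and sign of the weight on the row
  have hkb : ∀ x ∈ Ioo b c, |(g₂ * x + 2 * g₃) / (4 * x ^ 2)| ≤ Cb := fun x hx => hCb x (hrow x hx)
  have hwnn : ∀ x ∈ Ioo b c, 0 ≤ (Real.sqrt (f x))⁻¹ := fun x _ => inv_nonneg.2 (Real.sqrt_nonneg _)
  -- the fibres `(b, x)`, `x ∈ (b, c)`
  have hcd : ∀ x ∈ Ioo b c, b < x := fun x hx => hx.1
  have hJcd : ∀ x ∈ Ioo b c, Icc b x ⊆ Icc b c := fun x hx => Icc_subset_Icc_right hx.2.le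
  have hBcd : ∀ x ∈ Ioo b c, Ioo b x ⊆ Ioo b c := fun x hx => Ioo_subset_Ioo_right hx.2.le
  have hQc' : ∀ x ∈ Ioo b c, ContinuousOn Qf (Icc b x) := fun x hx => hQc.mono (hJcd x hx)
  have hQd : ∀ x ∈ Ioo b c, ∀ x' ∈ Ioo b x, HasDerivAt Qf
      (-(((g₂ * τ x' + 2 * g₃) / (4 * τ x' ^ 2) - (g₂ * x' + 2 * g₃) / (4 * x' ^ 2)) *
        (Real.sqrt (f x'))⁻¹)) x' := fun x hx x' hx' =>
    (hQder x' (hBcd x hx hx')).congr_deriv (foldStep_div_neg_eq _ _)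
  -- the three given representations in the shape of `stub_translationStep`
  have hSd' : Tsrc.domain = {z | z 0 ∈ Ioo b c ∧ b < z 1 ∧ z 1 < z 0} := by
    rw [hSd]
    ext z
    simp only [mem_setOf_eq, mem_Ioo]
    constructor
    · rintro ⟨h1, h2, h3⟩
      exact ⟨⟨h1.trans h2, h3⟩, h1, h2⟩
    · rintro ⟨⟨_, h3⟩, h1, h2⟩
      exact ⟨h1, h2, h3⟩
  have hSi' : EqOn Tsrc.integrand (fun z => (g₂ * z 1 + 2 * g₃) / (4 * z 1 ^ 2) *
      (Real.sqrt (f (z 0)))⁻¹ * (Real.sqrt (f (z 1)))⁻¹) Tsrc.domain := fun z hz =>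
    (hSi hz).trans (foldStep_div_mul_eq _ _ _)
  have hTd' : Ttgt.domain =
      (fun z : Fin 2 → ℝ => (![τ (z 0), τ (z 1)] : Fin 2 → ℝ)) '' Tsrc.domain := by
    rw [hTd, hSd]
    exact foldStep_image_halfCell hanti himg
  have hTi' : EqOn Ttgt.integrand (fun z => (g₂ * z 1 + 2 * g₃) / (4 * z 1 ^ 2) *
      (Real.sqrt (f (z 0)))⁻¹ * (Real.sqrt (f (z 1)))⁻¹) Ttgt.domain := fun z hz =>
    (hTi hz).trans (foldStep_div_mul_eq _ _ _)
  have hOd' : rO.domain = {t | t 0 ∈ Ioo b c} := hOd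
  have hOi' : EqOn rO.integrand (fun t => (Qf b - Qf (t 0)) * (Real.sqrt (f (t 0)))⁻¹)
      rO.domain := fun t ht => (hOi ht).trans (div_eq_mul_inv _ _)
  -- ONE application of the generic translation step
  exact stub_translationStep τ τ' τ τ' (fun x => (g₂ * x + 2 * g₃) / (4 * x ^ 2))
    (fun x => (g₂ * x + 2 * g₃) / (4 * x ^ 2)) (fun x => (Real.sqrt (f x))⁻¹)
    (fun x => (Real.sqrt (f x))⁻¹) (fun x => (Real.sqrt (f x))⁻¹) (fun x => (Real.sqrt (f x))⁻¹)
    Qf (fun _ => b) (fun x => x) (Ioo b c) (Ioo b c) (Ioo b c) (Ioo b c) (Icc b c) Cb Tsrc Ttgt rO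
    hAsa hAsa hAsa hAsa hJsa hτsa hτsa hτinj hτinj hτmaps hτmaps hτhaar hτhaar hwsa hwsa hwsa hwsa
    hksa hksa hkb hkb hwnn hwnn hint hint hbsa hX0 hcd hJcd hBcd hQsa hQc' hQd hSd' hSi' hTd' hTi'
    hOd' hOi'

end Summit.KontsevichZagierPeriods.KontsevichZagierPeriods.Cruxes.NeronTorsionSector.Translation

end
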